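import Literature.MathematicalPhysics.QuantumFieldTheory.Balaban1983to89.InfiniteVolumeSufficientIII
import Literature.MathematicalPhysics.QuantumFieldTheory.TorusPressureGateauxAnalytic
import HarnessLib

/-!
# Robust ball (Y2), area-law side — the free energy density is differentiable at every small coupling (Osterwalder–Seiler),
# every compact gauge group and every dimension; the number of coordinate planes

HONEST FRAMING: venture file of the cell `pub-ymgap` (QuantumFields programme), track ROBUST-BALL, seat rb-p2 (g7).  Generic LATTICE
statements (any compact second-countable `G`, continuous `ρ`, any `d`), used by `FreeEnergyLawAnalytic.lean`:
* `torusPressure_weight_eq` — the plaquette-weight form of the torus pressure: `|Λ|⁻¹ log ∫ ∏_q e^{β Re tr ρ(U_q)} e^{t Re tr ρ(U_q)} dHaar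
  = |Λ|⁻¹ log Z_{Λ, β+t} + #planes·N·(β+t)` (tree functional `torusLogPartition`, Wave-0 normalisation);
* ★ `exists_forall_differentiableAt_freeEnergyDensity` — there is `β₁ > 0` such that the free energy density `freeEnergyDensity d ρ` is
  differentiable at EVERY `|β| ≤ β₁` (no exceptional set): Osterwalder–Seiler analyticity of the strong-coupling pressure, in the tree as
  `exists_gateauxAnalytic_wilsonPressure` (Gateaux direction `Re tr ρ` = the coupling direction), identified with `freeEnergyDensity` by
  uniqueness of limits (`exists_hasFreeEnergyDensity_holds`).  `β₁` is existential here (Kotecký–Preiss radius); module XIII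
  `differentiableAt_freeEnergyDensity_of_abs_lt` has an explicit radius for `d = 4`;
* `card_planes_real` — `#planes(ℤ^{n+1}) = card {(i,j) : i < j} = n(n+1)/2` as a real number.
Nothing continuum / spectral / Clay.  0 compute.  Everything here is proved. [folklore]
-/

noncomputable section

open MeasureTheory Filter Topology Finset
open Literature.MathematicalPhysics.QuantumLattice
open Literature.MathematicalPhysics.QuantumFieldTheory hiding ZdEdge

namespace Summit.Ventures.YMGap.RobustBall

namespace FreeEnergyLaw

section Differentiable

variable {d N : ℕ} {G : Type*} [Group G] [TopologicalSpace G] [IsTopologicalGroup G]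
  [CompactSpace G] [MeasurableSpace G] [BorelSpace G] [SecondCountableTopology G]
  (ρ : G →* Matrix (Fin N) (Fin N) ℂ)

omit [SecondCountableTopology G] in
/-- The plaquette-weight form of the torus pressure: `|Λ|⁻¹ log ∫ ∏_q e^{β Re tr ρ(U_q)} e^{t Re tr ρ(U_q)} dHaar
= |Λ|⁻¹ log Z_{Λ, β+t} + #planes·N·(β + t)` (`e^{−(β+t)S} = e^{−(β+t)N#P} ∏_q e^{(β+t) Re tr U_q}`). [folklore] -/
theorem torusPressure_weight_eq (hρ : Continuous ρ) (β t : ℝ) (L : ℕ) :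
    (((L + 1 : ℕ) : ℝ) ^ d)⁻¹ * Real.log (∫ U : GaugeConfig d (L + 1) G, ∏ q : Plaquette d (L + 1),
        Real.exp (β * (ρ (plaquetteHolonomy U q.1 q.2.1.1 q.2.1.2)).trace.re) *
          Real.exp (t * (ρ (plaquetteHolonomy U q.1 q.2.1.1 q.2.1.2)).trace.re)
        ∂(Measure.pi fun _ : Edge d (L + 1) => haarProbability G)) =
      (((L + 1 : ℕ) : ℝ) ^ d)⁻¹ * torusLogPartition d ρ (β + t) (L + 1) +
        (Fintype.card {q : Fin d × Fin d // q.1 < q.2} : ℝ) * N * (β + t) := by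
  have hprod : ∀ U : GaugeConfig d (L + 1) G, (∏ q : Plaquette d (L + 1),
      Real.exp (β * (ρ (plaquetteHolonomy U q.1 q.2.1.1 q.2.1.2)).trace.re) *
        Real.exp (t * (ρ (plaquetteHolonomy U q.1 q.2.1.1 q.2.1.2)).trace.re)) =
      Real.exp ((β + t) * N * Fintype.card (Plaquette d (L + 1))) * Real.exp (-(β + t) * wilsonAction ρ U) := by
    intro U
    rw [Finset.prod_congr rfl fun q _ => (Real.exp_add _ _).symm, ← Real.exp_sum, ← Real.exp_add]
    congr 1
    have hcard : (β + t) * (N : ℝ) * (Fintype.card (Plaquette d (L + 1)) : ℝ) =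
        ∑ _q : Plaquette d (L + 1), (β + t) * (N : ℝ) := by
      rw [Finset.sum_const, Finset.card_univ, nsmul_eq_mul]; ring
    rw [wilsonAction, Finset.mul_sum, hcard, ← Finset.sum_add_distrib]
    exact Finset.sum_congr rfl fun q _ => by ring
  simp_rw [hprod]
  rw [integral_const_mul, Real.log_mul (Real.exp_pos _).ne' (integral_exp_neg_mul_wilsonAction_pos ρ hρ _).ne',
    Real.log_exp, ← torusLogPartition_eq_log_integral ρ hρ]
  have hcardP : (Fintype.card (Plaquette d (L + 1)) : ℝ) =
      ((L + 1 : ℕ) : ℝ) ^ d * (Fintype.card {q : Fin d × Fin d // q.1 < q.2} : ℝ) := by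
    rw [Fintype.card_prod, Fintype.card_fun, ZMod.card, Fintype.card_fin]; push_cast; ring
  rw [hcardP]
  have hpow : (((L + 1 : ℕ) : ℝ) ^ d) ≠ 0 := by positivity
  field_simp
  ring

/-- ★ **At strong coupling the free energy density is differentiable at EVERY coupling** (no exceptional set): there is
`β₁ > 0` with `f` differentiable at every `|β| ≤ β₁` — Osterwalder–Seiler analyticity of the pressure, in the tree as
`exists_gateauxAnalytic_wilsonPressure` (Gateaux-analyticity in the direction `Re tr ρ` = analyticity in the coupling). [folklore] -/
theorem exists_forall_differentiableAt_freeEnergyDensity (hρ : Continuous ρ) :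
    ∃ β₁ : ℝ, 0 < β₁ ∧ ∀ β : ℝ, |β| ≤ β₁ → DifferentiableAt ℝ (freeEnergyDensity d ρ) β := by
  obtain ⟨β₁, hβ₁, h⟩ := exists_gateauxAnalytic_wilsonPressure d ρ hρ
  refine ⟨β₁, hβ₁, fun β hβ => ?_⟩
  have hTc : Continuous fun g : G => (ρ g).trace.re := Complex.continuous_re.comp hρ.matrix_trace
  obtain ⟨p, hp, han⟩ := h β hβ (fun g => (ρ g).trace.re) hTc
  -- identify `p t = f(β + t) + #planes N (β + t)`
  have hpt : ∀ t : ℝ, p t = freeEnergyDensity d ρ (β + t) +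
      (Fintype.card {q : Fin d × Fin d // q.1 < q.2} : ℝ) * N * (β + t) := by
    intro t
    have h1 := hp t
    simp_rw [torusPressure_weight_eq (d := d) ρ hρ β t] at h1
    have h2 : Tendsto (fun L : ℕ => (((L + 1 : ℕ) : ℝ) ^ d)⁻¹ * torusLogPartition d ρ (β + t) (L + 1) +
        (Fintype.card {q : Fin d × Fin d // q.1 < q.2} : ℝ) * N * (β + t)) atTop
        (𝓝 (freeEnergyDensity d ρ (β + t) + (Fintype.card {q : Fin d × Fin d // q.1 < q.2} : ℝ) * N * (β + t))) :=
      (hasFreeEnergyDensity_freeEnergyDensity ρ (exists_hasFreeEnergyDensity_holds (d := d) ρ hρ (β + t))).add_const _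
    exact tendsto_nhds_unique h1 h2
  have hf : freeEnergyDensity d ρ = fun β' => p (β' - β) -
      (Fintype.card {q : Fin d × Fin d // q.1 < q.2} : ℝ) * N * β' := by
    funext β'
    rw [hpt (β' - β), add_sub_cancel]
    ring
  rw [hf]
  have hg : DifferentiableAt ℝ (fun β' : ℝ => β' - β) β := differentiableAt_id.sub_const β
  have hpd : DifferentiableAt ℝ p ((fun β' : ℝ => β' - β) β) := by
    simp only [sub_self]; exact han.differentiableAt
  have h1 : DifferentiableAt ℝ (fun β' : ℝ => p (β' - β)) β :=
    DifferentiableAt.comp (f := fun β' : ℝ => β' - β) (g := p) β hpd hg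
  exact h1.sub ((differentiableAt_const _).mul differentiableAt_id)

end Differentiable

section Planes

/-- `#planes(ℤ^{n+1}) = n(n+1)/2`, as a real number (`2·#{(i,j) : i<j} = d² − d`). [folklore] -/
theorem card_planes_real (n : ℕ) :
    (Fintype.card {q : Fin (n + 1) × Fin (n + 1) // q.1 < q.2} : ℝ) = n * (n + 1) / 2 := by
  have hswap : Fintype.card {p : Fin (n + 1) × Fin (n + 1) // p.2 < p.1} =
      Fintype.card {p : Fin (n + 1) × Fin (n + 1) // p.1 < p.2} :=
    Fintype.card_congr (Equiv.subtypeEquiv (Equiv.prodComm (Fin (n + 1)) (Fin (n + 1))) fun _ => Iff.rfl)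
  have hsum : Fintype.card {p : Fin (n + 1) × Fin (n + 1) // p.1 < p.2} +
      Fintype.card {p : Fin (n + 1) × Fin (n + 1) // p.2 < p.1} = (Finset.univ : Finset (Fin (n + 1))).offDiag.card := by
    rw [Fintype.card_subtype, Fintype.card_subtype, ← Finset.card_union_of_disjoint]
    · congr 1
      ext p
      simp only [Finset.mem_union, Finset.mem_filter, Finset.mem_univ, true_and, Finset.mem_offDiag]
      exact lt_or_lt_iff_ne
    · exact Finset.disjoint_filter.2 fun p _ h1 h2 => lt_asymm h1 h2
  rw [Finset.offDiag_card, Finset.card_univ, Fintype.card_fin, hswap] at hsum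
  have e : (n + 1) * (n + 1) - (n + 1) = n * (n + 1) := by
    rw [show (n + 1) * (n + 1) = n * (n + 1) + (n + 1) by ring, Nat.add_sub_cancel]
  rw [e] at hsum
  have h := congrArg (Nat.cast : ℕ → ℝ) hsum
  push_cast at h
  linarith

end Planes

end FreeEnergyLaw

end Summit.Ventures.YMGap.RobustBall
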